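import Literature.NumberTheory.LFunctions.SuzukiScrewLineProofs
import Literature.NumberTheory.LFunctions.ZetaZeroReciprocalSum
import Literature.NumberTheory.LFunctions.GeneralizedRH
import Mathlib.Analysis.Complex.LocallyUniformLimit
import Mathlib.Analysis.Normed.Module.Connected
import HarnessLib

/-!
# Suzuki's screw line: holomorphy of `𝔓_t`, `P_t` and the continuation step of CJM Prop 3.1

LINE 1 — LABEL: RH-FREE support theorems (no fact is discharged or asserted here). For
`Literature.NumberTheory.LFunctions.Suzuki2025_prop31` (M. Suzuki, Canad. J. Math. 2025 =
arXiv:2301.00421v3, **Prop 3.1** = arXiv:2209.04658 Prop 2.1: the meromorphic functions `𝔓_t` of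
(1.6) and `P_t` of (3.2) coincide) the printed proof (TeX l.789–980) establishes the identity for
`Im z > 1/2` by Weil's explicit formula and then says "the conclusion of the proposition follows by
analytic continuation". This file proves exactly that last step, as typed:

* `differentiableAt_screwZeroExpansion` — `P_t` (`screwZeroExpansion t`) is holomorphic on
  `ℂ ∖ Γ` (locally uniform convergence of (3.2) from `Σ_ρ m(ρ)/(1 + (Im ρ)²) < ∞`,
  `ZetaZeroSum.summable_zeroOrder_div_one_add_sq`);
* `differentiableAt_screwP` — `𝔓_t` (`screwP t`) is holomorphic off `Γ ∪ {0, i/2} ∪ {−i(2n+½)}`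
  (the typed exceptional set of `Suzuki2025_prop31`; `Γ′/Γ` is holomorphic off its poles because
  `1/Γ` is entire, `ScrewContinuation.analyticAt_digamma`);
* `Suzuki2025_prop31_of_im_gt` — **the reduction**: if for every `t > 0` the identity
  `𝔓_t(z) = P_t(z)` holds on some upper half-plane `Im z > c`, then `Suzuki2025_prop31` holds
  (identity theorem on the connected open set `ℂ ∖ (Γ ∪ {0, i/2} ∪ {−i(2n+½)})`, the complement of
  a countable set; `t = 0` by `screwP_zero` and `P_0 ≡ 0`; negative `t` via `|t|`).

bears_on: B-C/B-P (COLUMN 6 DBR). WHAT THIS IS NOT: the explicit-formula half of Prop 3.1 is NOT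
proved here (it needs Weil's formula for the non-compactly-supported test function `φ_{z,t}`);
nothing here bears on the truth of RH.

## References

* M. Suzuki, *On the Hilbert space derived from the Weil distribution*, Canad. J. Math. (2025)
  = arXiv:2301.00421v3, Prop 3.1 and its proof (TeX l.789–980). [Suzuki2025WeilHilbertSpace]
-/

noncomputable section

open Filter Topology Finset Complex Set

namespace Literature.NumberTheory.LFunctions

namespace ScrewContinuation

/-! ## `Γ` and `Γ′/Γ` off the poles -/

/-- `Γ` is analytic at every non-pole (`1/Γ` is entire and non-zero there). [folklore] -/
private theorem analyticAt_Gamma {s : ℂ} (hs : ∀ m : ℕ, s ≠ -m) : AnalyticAt ℂ Complex.Gamma s := by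
  have h1 : AnalyticAt ℂ (fun z : ℂ ↦ (Complex.Gamma z)⁻¹) s :=
    Complex.differentiable_one_div_Gamma.analyticAt s
  have h2 := h1.inv (inv_ne_zero (Complex.Gamma_ne_zero hs))
  have heq : (fun z : ℂ ↦ (Complex.Gamma z)⁻¹)⁻¹ = Complex.Gamma := by
    funext z; simp
  rwa [heq] at h2

/-- `ψ = Γ′/Γ` is analytic at every non-pole. [folklore] -/
private theorem analyticAt_digamma {s : ℂ} (hs : ∀ m : ℕ, s ≠ -m) :
    AnalyticAt ℂ Complex.digamma s := by
  have hΓ := analyticAt_Gamma hs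
  have h := hΓ.deriv.div hΓ (Complex.Gamma_ne_zero hs)
  have heq : Complex.digamma = fun z ↦ deriv Complex.Gamma z / Complex.Gamma z := by
    funext z; rw [Complex.digamma_def, logDeriv_apply]
  rw [heq]; exact h

/-! ## The Hurwitz–Lerch bracket is holomorphic off `z = −i(2n+½)` -/

/-- The pole condition: `n + (½ − iz)/2 = 0 ⟺ z = −i(2n+½)`. [folklore] -/
private theorem lerch_den_ne_zero {z : ℂ} (hz : ∀ n : ℕ, z ≠ -(I * (2 * n + 1 / 2))) (n : ℕ) :
    (n : ℂ) + (1 / 2 - I * z) / 2 ≠ 0 := by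
  intro h
  apply hz n
  have : z = -(I * (I * z)) := by rw [← mul_assoc, Complex.I_mul_I]; ring
  rw [this]
  congr 1
  linear_combination (-2 : ℂ) * I * h

/-- Uniform tail bound on a unit ball: for `n ≥ ‖z₀‖ + 1`, `z ∈ B(z₀,1)`,
`‖e^{−2|t|n}(1/(n + (½−iz)/2) − 1/(n+¼))‖ ≤ (‖z₀‖+1)/n²`. [folklore] -/
private theorem norm_lerch_term_le (t : ℝ) {z₀ z : ℂ} (hz : z ∈ Metric.ball z₀ 1) {n : ℕ}
    (hn : ‖z₀‖ + 1 ≤ n) :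
    ‖((Real.exp (-(2 * |t| * n)) : ℂ)) * (1 / ((n : ℂ) + (1 / 2 - I * z) / 2) - 1 / ((n : ℂ) + 1 / 4))‖ ≤
      (‖z₀‖ + 1) / (n : ℝ) ^ 2 := by
  rw [Metric.mem_ball, dist_eq_norm] at hz
  have hz' : ‖z‖ ≤ ‖z₀‖ + 1 := by
    have := norm_le_norm_add_norm_sub' z z₀  -- ‖z‖ ≤ ‖z₀‖ + ‖z - z₀‖
    linarith
  have hn0 : (0 : ℝ) < n := by linarith [norm_nonneg z₀]
  have hw : (n : ℝ) / 2 ≤ ‖(n : ℂ) + (1 / 2 - I * z) / 2‖ := by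
    have hre := Complex.abs_re_le_norm ((n : ℂ) + (1 / 2 - I * z) / 2)
    have e1 : ((n : ℂ) + (1 / 2 - I * z) / 2).re = n + 1 / 4 + z.im / 2 := by simp; ring
    rw [e1] at hre
    have him : |z.im| ≤ ‖z‖ := Complex.abs_im_le_norm z
    have h3 : (n : ℝ) / 2 ≤ n + 1 / 4 + z.im / 2 := by
      have := neg_abs_le z.im
      linarith
    exact h3.trans ((le_abs_self _).trans hre)
  have hq : ‖(n : ℂ) + 1 / 4‖ = (n : ℝ) + 1 / 4 := by
    have : ((n : ℂ) + 1 / 4) = (((n : ℝ) + 1 / 4 : ℝ) : ℂ) := by push_cast; ring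
    rw [this, Complex.norm_real, Real.norm_eq_abs, abs_of_pos (by positivity)]
  have hwne : (n : ℂ) + (1 / 2 - I * z) / 2 ≠ 0 := by
    intro h; rw [h, norm_zero] at hw; linarith
  have hqne : (n : ℂ) + 1 / 4 ≠ 0 := by
    intro h; rw [h, norm_zero] at hq; linarith
  have hdiff : 1 / ((n : ℂ) + (1 / 2 - I * z) / 2) - 1 / ((n : ℂ) + 1 / 4) =
      (I * z / 2) / (((n : ℂ) + (1 / 2 - I * z) / 2) * ((n : ℂ) + 1 / 4)) := by
    rw [div_sub_div _ _ hwne hqne]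
    congr 1
    ring
  have hexp : ‖((Real.exp (-(2 * |t| * n)) : ℂ))‖ ≤ 1 := by
    rw [Complex.norm_real, Real.norm_eq_abs, abs_of_pos (Real.exp_pos _), Real.exp_le_one_iff]
    have : (0 : ℝ) ≤ 2 * |t| * n := by positivity
    linarith
  rw [hdiff, norm_mul, norm_div, norm_mul, hq, norm_div, norm_mul, Complex.norm_I, one_mul,
    show ‖(2 : ℂ)‖ = 2 by simp]
  calc ‖((Real.exp (-(2 * |t| * n)) : ℂ))‖ * (‖z‖ / 2 / (‖(n : ℂ) + (1 / 2 - I * z) / 2‖ * ((n : ℝ) + 1 / 4)))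
      ≤ 1 * ((‖z₀‖ + 1) / 2 / ((n : ℝ) / 2 * (n : ℝ))) := by
        gcongr
        linarith
    _ = (‖z₀‖ + 1) / (n : ℝ) ^ 2 := by
        field_simp

/-- The Hurwitz–Lerch bracket `B(t, ·)` of (1.6) is holomorphic off the points `−i(2n+½)` (the
poles of its individual terms; part of "𝔓_t is a meromorphic function on ℂ").
[cite: Suzuki2025WeilHilbertSpace, §3.1 (TeX l.782–788)] -/
theorem differentiableAt_screwLerchBracket (t : ℝ) {z₀ : ℂ}
    (hz₀ : ∀ n : ℕ, z₀ ≠ -(I * (2 * n + 1 / 2))) :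
    DifferentiableAt ℂ (screwLerchBracket t) z₀ := by
  obtain ⟨F, hF⟩ : ∃ F : ℕ → ℂ → ℂ, F = fun (n : ℕ) (z : ℂ) ↦
      ((Real.exp (-(2 * |t| * (n : ℝ))) : ℂ)) *
        (1 / ((n : ℂ) + (1 / 2 - I * z) / 2) - 1 / ((n : ℂ) + 1 / 4)) := ⟨_, rfl⟩
  obtain ⟨N, hN⟩ : ∃ N : ℕ, N = ⌈‖z₀‖⌉₊ + 1 := ⟨_, rfl⟩
  have hN1 : ‖z₀‖ + 1 ≤ N := by
    rw [hN]; push_cast; linarith [Nat.le_ceil ‖z₀‖]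
  -- tail bound on the ball
  have htail_bound : ∀ (m : ℕ) (z : ℂ), z ∈ Metric.ball z₀ 1 →
      ‖F (m + N) z‖ ≤ (‖z₀‖ + 1) / ((m : ℝ) + 1) ^ 2 := by
    intro m z hz
    have hn : ‖z₀‖ + 1 ≤ ((m + N : ℕ) : ℝ) := by push_cast; linarith [(m.cast_nonneg : (0:ℝ) ≤ m)]
    have h := norm_lerch_term_le t hz hn
    have h1 : (m : ℝ) + 1 ≤ ((m + N : ℕ) : ℝ) := by
      push_cast; linarith [norm_nonneg z₀]
    have h0 : 0 ≤ ‖z₀‖ + 1 := by positivity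
    have h2 : (‖z₀‖ + 1) / (((m + N : ℕ) : ℝ)) ^ 2 ≤ (‖z₀‖ + 1) / ((m : ℝ) + 1) ^ 2 :=
      div_le_div_of_nonneg_left h0 (by positivity) (by gcongr)
    simp only [hF]
    exact h.trans h2
  have hu : Summable fun m : ℕ ↦ (‖z₀‖ + 1) / ((m : ℝ) + 1) ^ 2 := by
    have h1 : Summable (fun m : ℕ ↦ 1 / ((m + 1 : ℕ) : ℝ) ^ 2) :=
      (summable_nat_add_iff 1).mpr (Real.summable_one_div_nat_pow.mpr one_lt_two)
    have h2 := h1.mul_left (‖z₀‖ + 1)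
    refine h2.congr fun m ↦ ?_
    push_cast; ring
  -- the tail is holomorphic on the ball
  have hden_ball : ∀ (m : ℕ) (z : ℂ), z ∈ Metric.ball z₀ 1 →
      ((m + N : ℕ) : ℂ) + (1 / 2 - I * z) / 2 ≠ 0 := by
    intro m z hz h
    rw [Metric.mem_ball, dist_eq_norm] at hz
    have hre := congrArg Complex.re h
    simp at hre
    have him : |z.im| ≤ ‖z‖ := Complex.abs_im_le_norm z
    have hz' : ‖z‖ ≤ ‖z₀‖ + 1 := by
      have := norm_le_norm_add_norm_sub' z z₀; linarith
    have := neg_abs_le z.im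
    have hm : (0 : ℝ) ≤ m := m.cast_nonneg
    have hNr : ‖z₀‖ + 1 ≤ (N : ℝ) := hN1
    linarith
  have hterm : ∀ (n : ℕ) (z : ℂ), (n : ℂ) + (1 / 2 - I * z) / 2 ≠ 0 → DifferentiableAt ℂ (F n) z := by
    intro n z hne
    have hq : (n : ℂ) + 1 / 4 ≠ 0 := by
      intro h; have := congrArg Complex.re h; simp at this; linarith
    have h1 : DifferentiableAt ℂ (fun z : ℂ ↦ (n : ℂ) + (1 / 2 - I * z) / 2) z := by fun_prop
    have h2 : DifferentiableAt ℂ (fun z : ℂ ↦ ((Real.exp (-(2 * |t| * n)) : ℂ)) *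
        (1 / ((n : ℂ) + (1 / 2 - I * z) / 2) - 1 / ((n : ℂ) + 1 / 4))) z :=
      (differentiableAt_const _).mul (((differentiableAt_const _).div h1 hne).sub
        (differentiableAt_const _))
    rw [hF]
    exact h2
  have htail : DifferentiableOn ℂ (fun z ↦ ∑' m : ℕ, F (m + N) z) (Metric.ball z₀ 1) :=
    differentiableOn_tsum_of_summable_norm hu
      (fun m z hz ↦ (hterm (m + N) z (hden_ball m z hz)).differentiableWithinAt)
      Metric.isOpen_ball htail_bound
  -- the head is holomorphic at `z₀`
  have hhead : DifferentiableAt ℂ (fun z ↦ ∑ n ∈ Finset.range N, F n z) z₀ :=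
    DifferentiableAt.fun_sum fun n _ ↦ hterm n z₀ (lerch_den_ne_zero hz₀ n)
  -- summability on the ball and the split
  have hsum : ∀ z ∈ Metric.ball z₀ 1, Summable fun n ↦ F n z := by
    intro z hz
    rw [← summable_nat_add_iff N]
    exact Summable.of_norm_bounded hu (fun m ↦ htail_bound m z hz)
  have hev : (fun z ↦ (∑ n ∈ Finset.range N, F n z) + ∑' m : ℕ, F (m + N) z) =ᶠ[𝓝 z₀]
      screwLerchBracket t := by
    filter_upwards [Metric.isOpen_ball.mem_nhds (Metric.mem_ball_self zero_lt_one)] with z hz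
    rw [(hsum z hz).sum_add_tsum_nat_add N, hF]
    rfl
  exact ((hhead.add (htail.differentiableAt
    (Metric.isOpen_ball.mem_nhds (Metric.mem_ball_self zero_lt_one)))).congr_of_eventuallyEq
      hev.symm)

/-! ## `𝔓_t` is holomorphic off `Γ ∪ {0, i/2} ∪ {−i(2n+½)}` -/

/-- `ζ(½ − iz) ≠ 0` and `½ − iz ≠ 1` off the typed exceptional set. [folklore] -/
private theorem zeta_half_sub_I_mul_ne_zero {z : ℂ} (hzI : z ≠ I / 2)
    (hzn : ∀ n : ℕ, z ≠ -(I * (2 * n + 1 / 2)))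
    (hzΓ : ∀ ρ ∈ ZetaZeros.riemannZetaNontrivialZeros, z ≠ suzukiZeroParam ρ) :
    riemannZeta (1 / 2 - I * z) ≠ 0 ∧ (1 / 2 - I * z) ≠ 1 := by
  refine ⟨fun h ↦ ?_, fun h ↦ hzI (by linear_combination I * h + z * Complex.I_sq)⟩
  set s : ℂ := 1 / 2 - I * z with hs
  rcases le_or_gt s.re 0 with hre | hre
  · obtain ⟨n, hn⟩ := (riemannZeta_eq_zero_iff_of_re_nonpos hre).1 h
    apply hzn (n + 1)
    push_cast
    rw [hs] at hn
    linear_combination I * hn + z * Complex.I_sq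
  · rcases lt_or_ge s.re 1 with hre1 | hre1
    · have hmem : s ∈ ZetaZeros.riemannZetaNontrivialZeros :=
        mem_riemannZetaNontrivialZeros_iff_holds.2 ⟨h, hre, hre1⟩
      apply hzΓ s hmem
      rw [suzukiZeroParam, hs]
      linear_combination z * Complex.I_sq
    · exact riemannZeta_ne_zero_of_one_le_re hre1 h

/-- **`𝔓_t` is holomorphic off the typed exceptional set** `{0, i/2} ∪ {−i(2n+½)} ∪ Γ`
(each term of (1.6) is). [cite: Suzuki2025WeilHilbertSpace, §3.1 (TeX l.782–788, "𝔓_t … meromorphic")] -/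
theorem differentiableAt_screwP (t : ℝ) {z : ℂ} (hz0 : z ≠ 0) (hzI : z ≠ I / 2)
    (hzn : ∀ n : ℕ, z ≠ -(I * (2 * n + 1 / 2)))
    (hzΓ : ∀ ρ ∈ ZetaZeros.riemannZetaNontrivialZeros, z ≠ suzukiZeroParam ρ) :
    DifferentiableAt ℂ (screwP t) z := by
  have hIz : I * z ≠ 0 := mul_ne_zero Complex.I_ne_zero hz0
  have h2Iz : 2 * I * z ≠ 0 := mul_ne_zero (mul_ne_zero two_ne_zero Complex.I_ne_zero) hz0
  have hden1 : (1 : ℂ) + 2 * I * z ≠ 0 := fun h ↦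
    hzI (by linear_combination (-I / 2) * h + z * Complex.I_sq)
  have hden2 : (1 : ℂ) - 2 * I * z ≠ 0 := by
    intro h
    apply hzn 0
    push_cast
    linear_combination (I / 2) * h + z * Complex.I_sq
  obtain ⟨hζ, hs1⟩ := zeta_half_sub_I_mul_ne_zero hzI hzn hzΓ
  -- the six terms
  have hl1 : DifferentiableAt ℂ (fun z : ℂ ↦ 1 + 2 * I * z) z := by fun_prop
  have hl2 : DifferentiableAt ℂ (fun z : ℂ ↦ 1 - 2 * I * z) z := by fun_prop
  have h1 : DifferentiableAt ℂ (fun z : ℂ ↦ 4 * ((Real.exp (|t| / 2) - 1 : ℝ) : ℂ) / (1 + 2 * I * z)) z :=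
    (differentiableAt_const _).div hl1 hden1
  have h2 : DifferentiableAt ℂ (fun z : ℂ ↦ 4 * ((Real.exp (-(|t| / 2)) - 1 : ℝ) : ℂ) / (1 - 2 * I * z)) z :=
    (differentiableAt_const _).div hl2 hden2
  have hexpf : ∀ u : ℝ, DifferentiableAt ℂ (fun z : ℂ ↦ (cexp (-(I * z * u)) - 1) / (I * z)) z := by
    intro u
    have hx : DifferentiableAt ℂ (fun z : ℂ ↦ cexp (-(I * z * u)) - 1) z :=
      ((((differentiableAt_id.const_mul I).mul_const (u : ℂ)).neg).cexp).sub_const 1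
    exact hx.div ((differentiableAt_id.const_mul I)) hIz
  have hA : AnalyticAt ℂ riemannZeta (1 / 2 - I * z) :=
    DifferentiableOn.analyticAt (s := {1}ᶜ)
      (fun s hs ↦ (differentiableAt_riemannZeta hs).differentiableWithinAt)
      (isOpen_compl_singleton.mem_nhds hs1)
  have hq : DifferentiableAt ℂ (fun s ↦ deriv riemannZeta s / riemannZeta s) (1 / 2 - I * z) :=
    hA.deriv.differentiableAt.div hA.differentiableAt hζ
  have hlin : DifferentiableAt ℂ (fun z : ℂ ↦ 1 / 2 - I * z) z := by fun_prop
  have hcomp := hq.comp z hlin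
  have h3 : DifferentiableAt ℂ (fun z : ℂ ↦ (cexp (-(I * z * (|t| : ℝ))) - 1) / (I * z) *
      (deriv riemannZeta (1 / 2 - I * z) / riemannZeta (1 / 2 - I * z))) z :=
    (hexpf |t|).mul hcomp
  have h4 : DifferentiableAt ℂ (fun z : ℂ ↦ ∑ n ∈ Finset.Icc 1 ⌊Real.exp |t|⌋₊,
      ((ArithmeticFunction.vonMangoldt n / Real.sqrt n : ℝ) : ℂ) *
        ((cexp (-(I * z * ((|t| - Real.log n : ℝ) : ℂ))) - 1) / (I * z))) z :=
    DifferentiableAt.fun_sum fun n _ ↦ (differentiableAt_const _).mul (hexpf _)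
  have hψ : AnalyticAt ℂ Complex.digamma (1 / 4 - I * z / 2) := by
    refine analyticAt_digamma fun m h ↦ hzn m ?_
    linear_combination (2 * I) * h + z * Complex.I_sq
  have hlin2 : DifferentiableAt ℂ (fun z : ℂ ↦ 1 / 4 - I * z / 2) z := by fun_prop
  have hcomp2 := hψ.differentiableAt.comp z hlin2
  have hinv : DifferentiableAt ℂ (fun z : ℂ ↦ 1 / (2 * I * z)) z :=
    (differentiableAt_const _).div ((differentiableAt_id.const_mul (2 * I))) h2Iz
  have h5 : DifferentiableAt ℂ (fun z : ℂ ↦ 1 / (2 * I * z) *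
      (Complex.digamma (1 / 4 - I * z / 2) - Complex.digamma (1 / 4))) z :=
    hinv.mul (hcomp2.sub (differentiableAt_const _))
  have h6 : DifferentiableAt ℂ (fun z : ℂ ↦ 1 / (2 * I * z) * ((Real.exp (-(|t| / 2)) : ℝ) : ℂ) *
      screwLerchBracket t z) z :=
    (hinv.mul (differentiableAt_const _)).mul (differentiableAt_screwLerchBracket t hzn)
  have hall := ((((h1.add h2).add h3).add h4).sub h5).sub h6
  have heq : screwP t = fun z : ℂ ↦
      4 * ((Real.exp (|t| / 2) - 1 : ℝ) : ℂ) / (1 + 2 * I * z) +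
      4 * ((Real.exp (-(|t| / 2)) - 1 : ℝ) : ℂ) / (1 - 2 * I * z) +
      (cexp (-(I * z * (|t| : ℝ))) - 1) / (I * z) *
        (deriv riemannZeta (1 / 2 - I * z) / riemannZeta (1 / 2 - I * z)) +
      (∑ n ∈ Finset.Icc 1 ⌊Real.exp |t|⌋₊,
        ((ArithmeticFunction.vonMangoldt n / Real.sqrt n : ℝ) : ℂ) *
          ((cexp (-(I * z * ((|t| - Real.log n : ℝ) : ℂ))) - 1) / (I * z))) -
      1 / (2 * I * z) * (Complex.digamma (1 / 4 - I * z / 2) - Complex.digamma (1 / 4)) -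
      1 / (2 * I * z) * ((Real.exp (-(|t| / 2)) : ℝ) : ℂ) * screwLerchBracket t z := by
    funext w; rfl
  rw [heq]
  exact hall

/-! ## `P_t` is holomorphic off `Γ` -/

/-- For a non-trivial zero `ρ`: `|e^{−iγ(ρ)|t|}| ≤ e^{|t|/2}` (`Re(−iγ) = Re ρ − ½ < ½`). [folklore] -/
private theorem norm_cexp_zeroParam_le (t : ℝ) (ρ : ZetaZeros.riemannZetaNontrivialZeros) :
    ‖cexp (-(I * suzukiZeroParam (ρ : ℂ) * (|t| : ℝ))) - 1‖ ≤ Real.exp (|t| / 2) + 1 := by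
  obtain ⟨-, h0, h1⟩ := mem_riemannZetaNontrivialZeros_iff_holds.1 ρ.2
  have hre : (-(I * suzukiZeroParam (ρ : ℂ) * (|t| : ℝ))).re = ((ρ : ℂ).re - 1 / 2) * |t| := by
    simp [suzukiZeroParam]; ring
  calc ‖cexp (-(I * suzukiZeroParam (ρ : ℂ) * (|t| : ℝ))) - 1‖
      ≤ ‖cexp (-(I * suzukiZeroParam (ρ : ℂ) * (|t| : ℝ)))‖ + ‖(1 : ℂ)‖ := norm_sub_le _ _
    _ = Real.exp (((ρ : ℂ).re - 1 / 2) * |t|) + 1 := by rw [Complex.norm_exp, hre, norm_one]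
    _ ≤ Real.exp (|t| / 2) + 1 := by
        gcongr
        nlinarith [abs_nonneg t]

/-- `|Im ρ| ≤ |γ(ρ)|` (`Re γ(ρ) = −Im ρ`). [folklore] -/
private theorem abs_im_le_norm_zeroParam (ρ : ℂ) : |ρ.im| ≤ ‖suzukiZeroParam ρ‖ := by
  have h := Complex.abs_re_le_norm (suzukiZeroParam ρ)
  have : (suzukiZeroParam ρ).re = -ρ.im := by simp [suzukiZeroParam]
  rwa [this, abs_neg] at h

/-- **`P_t` is holomorphic on `ℂ ∖ Γ`**: the series (3.2) converges locally uniformly off `Γ`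
("converges absolutely and uniformly on every compact subset of `ℂ ∖ Γ`").
[cite: Suzuki2025WeilHilbertSpace, §3.1 (TeX l.776–781)] -/
theorem differentiableAt_screwZeroExpansion (t : ℝ) {z₀ : ℂ}
    (hz₀ : ∀ ρ ∈ ZetaZeros.riemannZetaNontrivialZeros, z₀ ≠ suzukiZeroParam ρ) :
    DifferentiableAt ℂ (screwZeroExpansion t) z₀ := by
  obtain ⟨H, hH⟩ : ∃ H : ZetaZeros.riemannZetaNontrivialZeros → ℂ → ℂ,
      H = fun (ρ : ZetaZeros.riemannZetaNontrivialZeros) (z : ℂ) ↦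
        (riemannZetaZeroOrder (ρ : ℂ) : ℂ) *
          ((cexp (-(I * suzukiZeroParam (ρ : ℂ) * (|t| : ℝ))) - 1) / suzukiZeroParam (ρ : ℂ)) *
          (1 / (z - suzukiZeroParam (ρ : ℂ))) := ⟨_, rfl⟩
  obtain ⟨E, hE⟩ : ∃ E : ℝ, E = Real.exp (|t| / 2) + 1 := ⟨_, rfl⟩
  obtain ⟨R, hR⟩ : ∃ R : ℝ, R = 2 * (‖z₀‖ + 2) := ⟨_, rfl⟩
  have hE0 : 0 < E := by rw [hE]; positivity
  set S : Finset ZetaZeros.riemannZetaNontrivialZeros := weilZeroFinset R with hS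
  -- each term is holomorphic off its pole
  have hterm : ∀ (ρ : ZetaZeros.riemannZetaNontrivialZeros) (z : ℂ), z ≠ suzukiZeroParam ρ →
      DifferentiableAt ℂ (H ρ) z := by
    intro ρ z hne
    rw [hH]
    exact (differentiableAt_const _).mul ((differentiableAt_const _).div (by fun_prop)
      (sub_ne_zero.2 hne))
  -- far zeros: uniform bound on the unit ball around `z₀`
  have hfar : ∀ (ρ : ZetaZeros.riemannZetaNontrivialZeros), ρ ∉ S → ∀ z ∈ Metric.ball z₀ 1,
      |(ρ : ℂ).im| / 2 ≤ ‖z - suzukiZeroParam ρ‖ ∧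
        ‖H ρ z‖ ≤ 4 * E * ((riemannZetaZeroOrder (ρ : ℂ) : ℝ) / (1 + (ρ : ℂ).im ^ 2)) := by
    intro ρ hρ z hz
    rw [hS, mem_weilZeroFinset, not_le] at hρ
    rw [Metric.mem_ball, dist_eq_norm] at hz
    have hz' : ‖z‖ ≤ ‖z₀‖ + 1 := by
      have := norm_le_norm_add_norm_sub' z z₀; linarith
    have hγ := abs_im_le_norm_zeroParam (ρ : ℂ)
    have hdist : |(ρ : ℂ).im| / 2 ≤ ‖z - suzukiZeroParam ρ‖ := by
      have h1 := norm_sub_norm_le (suzukiZeroParam (ρ : ℂ)) z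
      rw [norm_sub_rev] at h1
      have : R = 2 * (‖z₀‖ + 2) := hR
      linarith
    refine ⟨hdist, ?_⟩
    have him1 : 1 ≤ |(ρ : ℂ).im| := by
      have : R = 2 * (‖z₀‖ + 2) := hR
      linarith [norm_nonneg z₀]
    have hm0 : (0 : ℝ) ≤ riemannZetaZeroOrder (ρ : ℂ) := ZetaZeroSum.zeroOrder_nonneg ρ
    have hγpos : 0 < ‖suzukiZeroParam (ρ : ℂ)‖ := by linarith
    have hzpos : 0 < ‖z - suzukiZeroParam ρ‖ := by linarith
    rw [hH]
    simp only
    rw [norm_mul, norm_mul, norm_div, norm_div, norm_one, Complex.norm_intCast, abs_of_nonneg hm0]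
    calc (riemannZetaZeroOrder (ρ : ℂ) : ℝ) *
          (‖cexp (-(I * suzukiZeroParam (ρ : ℂ) * (|t| : ℝ))) - 1‖ / ‖suzukiZeroParam (ρ : ℂ)‖) *
          (1 / ‖z - suzukiZeroParam ρ‖)
        ≤ (riemannZetaZeroOrder (ρ : ℂ) : ℝ) * (E / |(ρ : ℂ).im|) * (1 / (|(ρ : ℂ).im| / 2)) := by
          gcongr
          · rw [hE]; exact norm_cexp_zeroParam_le t ρ
      _ = 2 * E * ((riemannZetaZeroOrder (ρ : ℂ) : ℝ) / (ρ : ℂ).im ^ 2) := by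
          rw [← sq_abs]
          field_simp
      _ ≤ 4 * E * ((riemannZetaZeroOrder (ρ : ℂ) : ℝ) / (1 + (ρ : ℂ).im ^ 2)) := by
          rw [show 4 * E * ((riemannZetaZeroOrder (ρ : ℂ) : ℝ) / (1 + (ρ : ℂ).im ^ 2)) =
            2 * E * ((riemannZetaZeroOrder (ρ : ℂ) : ℝ) * (2 / (1 + (ρ : ℂ).im ^ 2))) by ring,
            div_eq_mul_inv]
          have hE0' : 0 ≤ 2 * E := by positivity
          have him2 : 0 < ((ρ : ℂ)).im ^ 2 := by
            have := sq_abs ((ρ : ℂ)).im; nlinarith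
          refine mul_le_mul_of_nonneg_left (mul_le_mul_of_nonneg_left ?_ hm0) hE0'
          rw [inv_eq_one_div, div_le_div_iff₀ him2 (by positivity)]
          nlinarith [sq_abs (ρ : ℂ).im]
  -- summable majorant on the far zeros
  have hu : Summable fun ρ : {ρ : ZetaZeros.riemannZetaNontrivialZeros // ρ ∉ S} ↦
      4 * E * ((riemannZetaZeroOrder ((ρ : ZetaZeros.riemannZetaNontrivialZeros) : ℂ) : ℝ) /
        (1 + ((ρ : ZetaZeros.riemannZetaNontrivialZeros) : ℂ).im ^ 2)) :=
    (ZetaZeroSum.summable_zeroOrder_div_one_add_sq.mul_left (4 * E)).comp_injective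
      Subtype.val_injective
  have htail : DifferentiableOn ℂ
      (fun z ↦ ∑' ρ : {ρ : ZetaZeros.riemannZetaNontrivialZeros // ρ ∉ S}, H ρ z)
      (Metric.ball z₀ 1) := by
    refine differentiableOn_tsum_of_summable_norm hu (fun ρ z hz ↦ ?_) Metric.isOpen_ball
      (fun ρ z hz ↦ ((hfar ρ ρ.2 z hz).2))
    refine (hterm ρ z fun h ↦ ?_).differentiableWithinAt
    have h1 := (hfar ρ ρ.2 z hz).1
    rw [h, sub_self, norm_zero] at h1
    have hρ : ¬ |((ρ : ZetaZeros.riemannZetaNontrivialZeros) : ℂ).im| ≤ R :=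
      fun hle ↦ ρ.2 (mem_weilZeroFinset.2 hle)
    rw [not_le] at hρ
    linarith [norm_nonneg z₀]
  have hhead : DifferentiableAt ℂ (fun z ↦ ∑ ρ ∈ S, H ρ z) z₀ :=
    DifferentiableAt.fun_sum fun ρ _ ↦ hterm ρ z₀ (hz₀ ρ ρ.2)
  have hsum : ∀ z ∈ Metric.ball z₀ 1, Summable fun ρ ↦ H ρ z := by
    intro z hz
    exact (Finset.summable_compl_iff S).1
      (Summable.of_norm_bounded hu fun ρ ↦ (hfar ρ ρ.2 z hz).2)
  have hev : (fun z ↦ (∑ ρ ∈ S, H ρ z) +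
      ∑' ρ : {ρ : ZetaZeros.riemannZetaNontrivialZeros // ρ ∉ S}, H ρ z) =ᶠ[𝓝 z₀]
      screwZeroExpansion t := by
    filter_upwards [Metric.isOpen_ball.mem_nhds (Metric.mem_ball_self zero_lt_one)] with z hz
    rw [(hsum z hz).sum_add_tsum_subtype_compl S, hH]
    rfl
  exact ((hhead.add (htail.differentiableAt
    (Metric.isOpen_ball.mem_nhds (Metric.mem_ball_self zero_lt_one)))).congr_of_eventuallyEq
      hev.symm)


/-! ## The continuation step: from an upper half-plane to the typed domain -/

/-- `P_0 ≡ 0` (every term of (3.2) carries the factor `e^0 − 1 = 0`). [folklore] -/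
private theorem screwZeroExpansion_zero (z : ℂ) : screwZeroExpansion 0 z = 0 := by
  simp [screwZeroExpansion]

/-- `𝔓_{|t|} = 𝔓_t` (the definition is in the variable `|t|`). [folklore] -/
private theorem screwP_abs (t : ℝ) : screwP |t| = screwP t := by
  funext z; simp only [screwP, screwLerchBracket, abs_abs]

/-- `P_{|t|} = P_t`. [folklore] -/
private theorem screwZeroExpansion_abs (t : ℝ) : screwZeroExpansion |t| = screwZeroExpansion t := by
  funext z; simp only [screwZeroExpansion, abs_abs]

/-- `1/Γ(¼ − iz/2) ≠ 0 ⟺ z ∉ {−i(2n+½)}`. [folklore] -/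
private theorem gamma_inv_ne_zero_iff {z : ℂ} :
    (Complex.Gamma (1 / 4 - I * z / 2))⁻¹ ≠ 0 ↔ ∀ n : ℕ, z ≠ -(I * (2 * n + 1 / 2)) := by
  rw [ne_eq, inv_eq_zero, Complex.Gamma_eq_zero_iff, not_exists]
  refine forall_congr' fun n ↦ ⟨fun h hz ↦ h ?_, fun h hw ↦ h ?_⟩
  · rw [hz]; linear_combination ((n : ℂ) + 1 / 4) * Complex.I_sq
  · linear_combination (2 * I) * hw + z * Complex.I_sq

/-- `ξ(½ − iz) ≠ 0 ⟺ z ∉ Γ`. [folklore] -/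
private theorem xi_ne_zero_iff {z : ℂ} :
    riemannXi (1 / 2 - I * z) ≠ 0 ↔
      ∀ ρ ∈ ZetaZeros.riemannZetaNontrivialZeros, z ≠ suzukiZeroParam ρ := by
  constructor
  · intro h ρ hρ hz
    apply h
    rw [hz, one_half_sub_I_mul_suzukiZeroParam]
    exact (riemannXi_eq_zero_iff_holds ρ).2 (mem_riemannZetaNontrivialZeros_iff_holds.1 hρ)
  · intro h hxi
    have hmem : (1 / 2 - I * z) ∈ ZetaZeros.riemannZetaNontrivialZeros :=
      mem_riemannZetaNontrivialZeros_iff_holds.2 ((riemannXi_eq_zero_iff_holds _).1 hxi)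
    apply h _ hmem
    rw [suzukiZeroParam]
    linear_combination z * Complex.I_sq

/-- A base point `i(|c| + 2)` of the typed domain in the half-plane `Im z > c`. [folklore] -/
private theorem basePoint_mem (c : ℝ) :
    (I * ((|c| : ℝ) + 2 : ℂ)) ≠ 0 ∧ (I * ((|c| : ℝ) + 2 : ℂ)) ≠ I / 2 ∧
      (Complex.Gamma (1 / 4 - I * (I * ((|c| : ℝ) + 2 : ℂ)) / 2))⁻¹ ≠ 0 ∧
      riemannXi (1 / 2 - I * (I * ((|c| : ℝ) + 2 : ℂ))) ≠ 0 := by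
  have hc : 0 ≤ |c| := abs_nonneg c
  refine ⟨?_, ?_, ?_, ?_⟩
  · intro h; have := congrArg Complex.im h; simp at this; linarith
  · intro h; have := congrArg Complex.im h; simp at this; linarith
  · rw [gamma_inv_ne_zero_iff]
    intro n h; have := congrArg Complex.im h; simp at this
    linarith [(n.cast_nonneg : (0 : ℝ) ≤ n)]
  · refine riemannXi_ne_zero_of_one_le_re ?_
    have : (1 / 2 - I * (I * ((|c| : ℝ) + 2 : ℂ))) = (((1 / 2 + |c| + 2 : ℝ)) : ℂ) := by
      push_cast; linear_combination (-(((|c| : ℝ) : ℂ)) - 2) * Complex.I_sq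
    rw [this, Complex.ofReal_re]; linarith

/-- **The continuation step of CJM Prop 3.1.** If for every `t > 0` the identity `𝔓_t = P_t`
holds on some upper half-plane `Im z > c` (the printed proof obtains it for `Im z > ½` from Weil's
explicit formula applied to `φ_{z,t}`), then `Suzuki2025_prop31` holds: both sides are
holomorphic on the typed domain `ℂ ∖ (Γ ∪ {0, i/2} ∪ {−i(2n+½)})`, which is the complement of a
countable set and hence connected, so the identity theorem applies; `t = 0` by `𝔖_0 ≡ 0`
(`screwP_zero`) and `P_0 ≡ 0`; negative `t` through `|t|` ("the conclusion of the proposition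
follows by analytic continuation"). [cite: Suzuki2025WeilHilbertSpace, Prop. 3.1 proof (TeX l.834–836)] -/
theorem Suzuki2025_prop31_of_im_gt
    (h : ∀ t : ℝ, 0 < t → ∃ c : ℝ, ∀ z : ℂ, c < z.im → screwP t z = screwZeroExpansion t z) :
    Suzuki2025_prop31 := by
  -- the typed domain
  obtain ⟨U, hU⟩ : ∃ U : Set ℂ, U = {z : ℂ | z ≠ 0} ∩ {z | z ≠ I / 2} ∩
      {z | (Complex.Gamma (1 / 4 - I * z / 2))⁻¹ ≠ 0} ∩ {z | riemannXi (1 / 2 - I * z) ≠ 0} :=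
    ⟨_, rfl⟩
  have hmemU : ∀ {z : ℂ}, z ∈ U ↔ z ≠ 0 ∧ z ≠ I / 2 ∧ (∀ n : ℕ, z ≠ -(I * (2 * n + 1 / 2))) ∧
      ∀ ρ ∈ ZetaZeros.riemannZetaNontrivialZeros, z ≠ suzukiZeroParam ρ := by
    intro z
    rw [hU]
    simp only [mem_inter_iff, mem_setOf_eq, gamma_inv_ne_zero_iff, xi_ne_zero_iff, and_assoc]
  -- it is open
  have hUo : IsOpen U := by
    have hc1 : Continuous fun z : ℂ ↦ (Complex.Gamma (1 / 4 - I * z / 2))⁻¹ :=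
      Complex.differentiable_one_div_Gamma.continuous.comp (by fun_prop)
    have hc2 : Continuous fun z : ℂ ↦ riemannXi (1 / 2 - I * z) :=
      differentiable_riemannXi.continuous.comp (by fun_prop)
    rw [hU]
    exact (((isOpen_ne_fun continuous_id continuous_const).inter
      (isOpen_ne_fun continuous_id continuous_const)).inter
      (isOpen_ne_fun hc1 continuous_const)).inter (isOpen_ne_fun hc2 continuous_const)
  -- it is the complement of a countable set, hence preconnected
  have hcount : (Uᶜ).Countable := by
    have hT : (Set.range fun n : ℕ ↦ -(I * (2 * (n : ℂ) + 1 / 2))).Countable := countable_range _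
    have hΓ : (suzukiZeroParam '' ZetaZeros.riemannZetaNontrivialZeros).Countable :=
      riemannZetaNontrivialZeros_countable.image _
    refine ((((Set.countable_singleton (0 : ℂ)).union (Set.countable_singleton (I / 2))).union
      hT).union hΓ).mono fun z hz ↦ ?_
    rw [mem_compl_iff, hmemU] at hz
    simp only [Set.mem_union, Set.mem_singleton_iff, Set.mem_range, Set.mem_image]
    by_contra hcon
    apply hz
    refine ⟨?_, ?_, ?_, ?_⟩
    · exact fun h0 ↦ hcon (Or.inl (Or.inl (Or.inl h0)))
    · exact fun hI ↦ hcon (Or.inl (Or.inl (Or.inr hI)))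
    · exact fun n hn ↦ hcon (Or.inl (Or.inr ⟨n, hn.symm⟩))
    · exact fun ρ hρ hzρ ↦ hcon (Or.inr ⟨ρ, hρ, hzρ.symm⟩)
  have hUconn : IsPreconnected U := by
    have h2 : 1 < Module.rank ℝ ℂ := by
      rw [← Module.finrank_eq_rank, Complex.finrank_real_complex]; norm_num
    have := (hcount.isPathConnected_compl_of_one_lt_rank h2).isConnected.isPreconnected
    rwa [compl_compl] at this
  -- holomorphy of both sides on `U`
  have hP : ∀ s : ℝ, AnalyticOnNhd ℂ (screwP s) U := by
    intro s
    have hd : DifferentiableOn ℂ (screwP s) U := fun z hz ↦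
      (differentiableAt_screwP s (hmemU.1 hz).1 (hmemU.1 hz).2.1 (hmemU.1 hz).2.2.1
        (hmemU.1 hz).2.2.2).differentiableWithinAt
    exact hd.analyticOnNhd hUo
  have hZ : ∀ s : ℝ, AnalyticOnNhd ℂ (screwZeroExpansion s) U := by
    intro s
    have hd : DifferentiableOn ℂ (screwZeroExpansion s) U := fun z hz ↦
      (differentiableAt_screwZeroExpansion s (hmemU.1 hz).2.2.2).differentiableWithinAt
    exact hd.analyticOnNhd hUo
  -- identity theorem from a half-plane `Im z > c`
  have key : ∀ (s c : ℝ), (∀ z : ℂ, c < z.im → screwP s z = screwZeroExpansion s z) →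
      EqOn (screwP s) (screwZeroExpansion s) U := by
    intro s c hc
    obtain ⟨hb0, hbI, hbG, hbX⟩ := basePoint_mem c
    have hz₀ : (I * ((|c| : ℝ) + 2 : ℂ)) ∈ U := by
      rw [hU]; exact ⟨⟨⟨hb0, hbI⟩, hbG⟩, hbX⟩
    have him : c < (I * ((|c| : ℝ) + 2 : ℂ)).im := by
      simp; linarith [le_abs_self c]
    have hev : screwP s =ᶠ[𝓝 (I * ((|c| : ℝ) + 2 : ℂ))] screwZeroExpansion s :=
      Filter.eventually_of_mem ((isOpen_lt continuous_const Complex.continuous_im).mem_nhds him)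
        fun z hz ↦ hc z hz
    exact (hP s).eqOn_of_preconnected_of_eventuallyEq (hZ s) hUconn hz₀ hev
  -- assemble
  intro t z hz0 hzI hzn hzΓ
  have hzU : z ∈ U := hmemU.2 ⟨hz0, hzI, hzn, hzΓ⟩
  rw [← screwP_abs, ← screwZeroExpansion_abs]
  rcases (abs_nonneg t).eq_or_lt with h0 | hpos
  · rw [← h0]
    refine key 0 (-1 / 2) (fun w hw ↦ ?_) hzU
    rw [screwP_zero hw, screwZeroExpansion_zero]
  · obtain ⟨c, hc⟩ := h |t| hpos
    exact key |t| c hc hzU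

end ScrewContinuation

/-- Re-export under the file's main namespace: the continuation step of CJM Prop 3.1
(`ScrewContinuation.Suzuki2025_prop31_of_im_gt`). [cite: Suzuki2025WeilHilbertSpace, Prop. 3.1 proof (TeX l.834–836)] -/
theorem Suzuki2025_prop31_of_im_gt
    (h : ∀ t : ℝ, 0 < t → ∃ c : ℝ, ∀ z : ℂ, c < z.im → screwP t z = screwZeroExpansion t z) :
    Suzuki2025_prop31 :=
  ScrewContinuation.Suzuki2025_prop31_of_im_gt h


/-- Fixed half-plane form of the continuation step (`Im z > 1`, the target announced by the seat
proving the explicit-formula half). [cite: Suzuki2025WeilHilbertSpace, Prop. 3.1 proof (TeX l.834–836)] -/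
theorem Suzuki2025_prop31_of_im_gt_one
    (h : ∀ t : ℝ, 0 < t → ∀ z : ℂ, 1 < z.im → screwP t z = screwZeroExpansion t z) :
    Suzuki2025_prop31 :=
  Suzuki2025_prop31_of_im_gt fun t ht ↦ ⟨1, h t ht⟩

end Literature.NumberTheory.LFunctions

end
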